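import Summits.QuantumFields.YangMills.Theorems.BalabanUVNodesN12DirectChartPackageOfClassRowL1
import Literature.MathematicalPhysics.QuantumFieldTheory.Balaban1983to89.Node00.MultiScaleFibreChartB
import Summits.QuantumFields.YangMills.Theorems.BalabanUVNodesN12DirectChartCurrentOfSupport
import Literature.MathematicalPhysics.QuantumFieldTheory.Balaban1983to89.Node00.MultiScaleFibreChartCurvatureUniformB
import Literature.MathematicalPhysics.QuantumFieldTheory.Balaban1983to89.Node00.MultiScaleFibreChartLocalityComponentB
import Summits.QuantumFields.YangMills.Theorems.BalabanUVNodesN12NearFlatDelta2LetterComponentB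
import Summits.QuantumFields.YangMills.Theorems.BalabanUVNodesN12DirectChartLetterCoreB
import Summits.QuantumFields.YangMills.Theorems.BalabanUVNodesN12TowerProxiesOfClassB
import Summits.QuantumFields.YangMills.Theorems.BalabanUVNodesN12NearFlatFederbushVelocityWindowB
import HarnessLib

/-!
# DAG node N12 [B15] — THE DIRECT ROAD's CHART ROWS AND CHART HALF WITH THE (μ) ROW KEYED ON PER-ROW ℓ¹ PREIMAGES (uniformity pen ρ6b, census §7 U2b at the consumer): the — **BOND-DATUM EDITION** (`…N12DirectChartPackageOfClassRowL1B`, USED DECLARATIONS ONLY)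

The print-datum ([Balaban1984PropagatorsII] (2.3)) (γ) twin of `Summits/…/Theorems/BalabanUVNodesN12DirectChartPackageOfClassRowL1.lean`: the declarations of the parent whose STATEMENT reads the determining datum
(`chartRows_direct_of_class_rowl1`, `exists_hWD_chartHalf_of_class_uniform_rowl1`) and which N12's junction of record v14ᴸ uses (dag-n12-c g35 probe-2 census `UsedConstsN12RoadTyped2`, THEOREMS block), re-typed over a
BOND-LEVEL datum `𝔅 : BDetSet` (F0a `B15DeterminingSetsB`) and dag-n12-c's bond-datum chart `Node00.msChartB` (✓p774329; `msChart 𝐁 = msChartB (bondsDet 𝐁)` by `rfl`).  GENERATOR twin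
(this seat's `work/g32/gen_thm.py`, block-extracted from the parent's tree bytes): namespace `…N12DirectChartPackageOfClassRowL1B`, SAME short names, `DetSet ↦ BDetSet`, `AgreeOn 𝐁 ↦ AgreeOnB 𝔅`,
`IsMinimizer ↦ IsMinimizerB`, `bondsOf (𝐁 j) ↦ 𝔅 j`, `msChart ∕ constrCard ∕ constrEnum ∕ ConstrSet ↦ …B`, NODE 00 chart lemmas `…msChart… ↦ …msChartB…`; proofs VERBATIM; the parent's
datum-free declarations REUSED BY NAME (`open`), never copied (private plumbing excepted, №366 R2).  The parent's (b) statements are the instances `𝔅 := bondsDet 𝐁`.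
STRUCTURAL RE-KEY AT LEVEL 0 (dag-n12-c RE-KEY NOTE I.18590, the `S`-device): the SUPPORT SET of the chart rows is DISPLAYED — binders `(S₀ : Set (PBond (F.P Kt) 0)) (hS₀ : ∀ b ∉ S₀, b ∈ lamBondsSeq (maxDomT ν.M₁ Z) k 0)`; the plaquette-smallness row `hP` is asked on the plaquettes meeting `S₀` and the one-row preimages vanish off `S₀` (print: `S₀ := {b | b₋ ∈ Ω₁ ∨ b₊ ∈ Ω₁}`, `hS₀` = n12-c`s `mem_lamDatumP_maxDomT_zero_of_not_mem₂`); the current factor is the NEW generic-support lemma `abs_fderiv_wilsonAction4_expChart_apply_le_of_plaqSmall_supp`; the top-level twist rows go through F0a `lamBondsSeq_of_le`.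
Cell `pub-ymgap` (HUMAN RULINGS D-0062 ∕ D-0149), seat `pub-ymgap-dag-n12-d` g32 (R134 N12 [B15] s2; the (ii) Theorems-side re-key of N12's road at print's [II] (2.3) datum — director-ym №338 ∕
№343 (E1)(iii-b), FLAG №16 ∕ ruling (α); dag-n12-c DESIGN memo a793b2ebc0b803bf (ii); `N12-ROAD-TWIN-ORDER-2026-08-30.md`).  Count-neutral helper of K1⁹ `stmt-QuantumFields-27364`,
`--kind proof --supports … --as helper`.  THEOREMS ONLY (0 `def`, 0 `instance`, 0 `sorry`).

HONEST FRAMING (director-ym №338 (5)).  PURELY ADDITIVE: the parent stays landed and true on its own text; nothing in it is edited; no displayed premise of any consumer is deleted or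
weakened; every hypothesis of the parent stays a hypothesis.  Nothing of Bałaban's analysis asserted; N12 NOT discharged; K0⁷ ∕ K1⁹ NOT closed; counts unmoved (typed 28∕28 · discharged
8∕27, A 8∕28; K 1∕4); one finite 𝕋⁴ programme at fixed ε — R4 closes the conditional rung `BalabanLadder.UV` only; NOT the Yang–Mills mass gap (Clay); nothing continuum ∕ ℝ⁴ ∕ OS.

PARENT's DOCSTRING (the mathematics and the citations; read the site-level `𝐁` as the bond datum `𝔅`):
(see the parent module — not reproduced here, 400-line lint; the citations of every declaration below are carried in its own docstring)
-/

noncomputable section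
open scoped BigOperators Matrix.Norms.L2Operator Topology
open Filter Finset

namespace Summit.QuantumFields.YangMills.BalabanUVNodes.N12DirectChartPackageOfClassRowL1B

open Literature.MathematicalPhysics.QuantumFieldTheory.Balaban1983to89.B15DeterminingSetsB

open Literature.MathematicalPhysics.QuantumFieldTheory.Balaban1983to89
open Literature.MathematicalPhysics.QuantumLattice (quatMatrix)
open T4Continuum (T4Family)
open T4HaarSU2ExpChart (imQuat)
open T4AdjointCovarianceUnitary (lieSU)
open T4CubeChartGnomonic (SU2)
open B15DeterminingSets GaugeField
open B14.Eq213DetSet (Bj Bj_of_gt maxDomT)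
open B14.Eq216Concrete (feeds)
open B15Prop1SliceCoordinates (GaugeSlice ιA)
open B15Prop1ChartCalculusSU2 (E3)
open B15Prop1ChartSU2 (su2Chart)
open B16Sect1Backgrounds (expMul)
open T4AxialGaugeSmallField (castSite)
open B6TreeGaugePoincare (curl)
open B16Eq18Proof (box)
open LatticeFieldCalculus (runSite)
open BlockAveragingEMLLinearised (linAvg)
open Literature.MathematicalPhysics.QuantumFieldTheory.BalabanImbrieJaffe1984to88.BIJ85Eq453GaugeField (qsstarGIter0)
open Node00
open B16Ineq19FlatSliceChart (exists_lieSU2Coord)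
open Summit.QuantumFields.YangMills.BalabanUVNodes.N12NearFlatChartLetter (sum_opNorm_sq_le_l2Seminorm_sq l2Seminorm_le_of_bound_of_support
  l2Seminorm_le_sqrt_card_mul_norm sum_opNorm_le_sqrt_card_mul_l2Seminorm l2Seminorm_apply l2Seminorm_sq)
open Summit.QuantumFields.YangMills.BalabanUVNodes.N12RightInverseLevelZeroLocality (mem_bondsOf_Bj_zero)
open B16Ineq17NearFlatWilsonLetters (fderiv_wilsonAction4_expChart_apply_eq_deriv)
open Summit.QuantumFields.YangMills.BalabanUVNodes.N12NearFlatFederbushFibreRecord (hcons_of_plaqsInside_maxDomT)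
open Summit.QuantumFields.YangMills.BalabanUVNodes.N12NearFlatFederbushFibreWindowKnit (runSite_runSite_blockSite_mem_tower)
open Summit.QuantumFields.YangMills.BalabanUVNodes.N12NearFlatFederbushVelocityWindow (exists_hmX_federbush_window_of_isMinimizer_family)
open Summit.QuantumFields.YangMills.BalabanUVNodes.N12DirectChartLetterCore (abs_fderiv_wilsonAction4_expChart_apply_le_of_plaqSmall norm_le_sqrt_sum_sq)
open Summit.QuantumFields.YangMills.BalabanUVNodes.N12DirectChartLetterCoreB (exists_twistSize_of_nearFlat_feeds)
open Summit.QuantumFields.YangMills.BalabanUVNodes.N12DirectChartLetterHSupportVacuity (hHsupp_levelZeroFree_of_rightInverse fderiv_fderiv_msChart_levelZeroFree_direct)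
open Summit.QuantumFields.YangMills.BalabanUVNodes.N12NearFlatFederbushVelocityWindowB (hmX_federbush_window_of_delta2Component)
open Summit.QuantumFields.YangMills.BalabanUVNodes.N12NearFlatDelta2LetterComponentB (exists_delta2_letter_component)
open Summit.QuantumFields.YangMills.BalabanUVNodes.N12DirectChartLetterHSupportVacuity (rightInverse_apply_levelZero)
open Summit.QuantumFields.YangMills.BalabanUVNodes.N12TowerProxiesOfClassB (chartLetters_msChart_lamBondsSeq_of_isMinimizer_of_class exists_lam_msChart_lamBondsSeq_of_isMinimizer_regMSCoPOfRecord_of_class)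
open B14.Eq213MaximalDomains (side)
open B16Ineq19NearFlatSliceNorms (opNorm_coe_le_norm_lieSU)
open Summit.QuantumFields.YangMills.BalabanUVNodes.N12DirectChartCurrentOfSupport (abs_fderiv_wilsonAction4_expChart_apply_le_of_plaqSmall_supp)

section
variable {F : T4Family}

/-- ★★★ **THE DIRECT CHART ROWS, (μ) KEYED ON PER-ROW ℓ¹ PREIMAGES** — ρ6's `N12DirectChartPackageOfClassL1.chartRows_direct_of_class_l1` VERBATIM except: the right inverse
`(H, hHinv)` carries NO size letter (it only witnesses surjectivity of `DΨ(0)`, hence the multiplier), and the (μ) row reads the PER-ROW ℓ¹ PREIMAGE LETTER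
`hrow : ∀ i, 1 ≤ level i → ∀ ξ, ∃ x, DΨ(0) x = e_i ξ ∧ Σ_b ‖↑x_b‖_op ≤ B₁‖ξ‖`, and the (K) row reads the ℓ² velocity letter `hK2 : √(Σ_b ‖(X_f′X)_b‖²) ≤ K₂‖X‖` (so `(K)` is
`p(X_f′X) ≤ K₂‖X‖` and `R, 𝓐₀, hKb, hsupp` are gone); (μ) constant `2(d−1)·ε_P·B₁·M₂`.  Proof: `λ` is linear, `v = Σ_i e_i v_i`; a
level-0 row of `v = D²Ψ(0)(Y,Y)` vanishes (exact Γ₀ layer, dag-n12-w4); a positive-level one-row term is `D(A∘expChart U₀)(0) x_i` for the letter's preimage `x_i`, which vanishes off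
`Ω₁(Z)` (`(DΨ(0) x_i)(idx b) = (x_i)_b` at every level-0 row), so the plaquette-small current bounds it by `2(d−1)·ε_P·B₁‖v_i‖`.
[cite: Balaban1989LargeFieldII, p.357, (1.12)–(1.13) p.359; Balaban1985Variational, Sect. C (44)–(48) p.285, (81)–(83) p.290, (170)–(171) p.305; Balaban1988Convergent, (2.2) p.255, (2.11)–(2.13) pp.256–257] -/
theorem chartRows_direct_of_class_rowl1 (ν : Node00.Stage7Numerics) (Kt : ℕ) {k : ℕ} (_hk0 : 0 < k)
    (Z Λ : Set (Site (F.P Kt) 0)) (T : Finset (PBond (F.P Kt) k))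
    (ext : GaugeField (F.P Kt) k SU2 → GaugeField (F.P Kt) k SU2) (Vk : GaugeField (F.P Kt) k SU2)
    (U₀ : GaugeField (F.P Kt) 0 SU2) (Xf : GaugeSlice (pts k Λ) T E3 → PBond (F.P Kt) 0 → lieSU (Fin 2))
    (hmin0 : IsMinimizerB (Node00.avOfRecord F 2 Kt) (Node00.regMSCoPOfRecord F 2 ν Kt k (maxDomT ν.M₁ Z)) (lamBondsSeq (maxDomT ν.M₁ Z) k)
      (avgFamily (Node00.avOfRecord F 2 Kt) (qsstarGIter0 k (ext Vk))) U₀)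
    -- LOCATED-HSB: NO global small-below guard at `U₀` — the chart letters are read off the minimiser's own (2.12) class through per-bond proxies (`N12TowerProxiesOfClass`);
    -- its rows: the height fits, `4L ≤ M₁`, the cube divisibility, `0 ≤ εreg`, the per-height radius letter `hsbU` and ONE volume-free floor on `εreg`
    (hkK : k + 1 ≤ (F.P Kt).m + (F.P Kt).K) (hM4 : 4 * (F.P Kt).L ≤ ν.M₁) (hdiv : side (F.P Kt).L ν.M₁ k ∣ (F.P Kt).sitesPerDir 0) (hε : 0 ≤ ν.εreg)
    {ρ'' : ℝ} (hsbU : ∀ V : GaugeField (F.P Kt) 0 SU2, ‖coeField V - 1‖ ≤ ρ'' → SmallBelow (Node00.avOfRecord F 2 Kt) k V)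
    (hερ : 6 * ((((F.P Kt).d - 1 : ℕ)) : ℝ) * (F.P Kt).L * ν.εreg ≤ ρ'')
    -- P1: plaquette smallness where the first variation is read (displayed, gauge-invariant)
    (S₀ : Set (PBond (F.P Kt) 0)) (hS₀ : ∀ b ∉ S₀, b ∈ lamBondsSeq (maxDomT ν.M₁ Z) k 0) {εP : ℝ} (hεP0 : 0 ≤ εP)
    (hP : ∀ p : Plaq (F.P Kt) 0, ((⟨p.src, p.μ⟩ : PBond (F.P Kt) 0) ∈ S₀ ∨
          (⟨p.src.shift p.μ, p.ν⟩ : PBond (F.P Kt) 0) ∈ S₀ ∨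
          (⟨p.src.shift p.ν, p.μ⟩ : PBond (F.P Kt) 0) ∈ S₀ ∨
          (⟨p.src, p.ν⟩ : PBond (F.P Kt) 0) ∈ S₀) →
      ‖((GaugeField.plaqHol U₀ p : SU2) : Matrix (Fin 2) (Fin 2) ℂ) - 1‖ ≤ εP)
    -- hH: a right inverse ((P4)′ socket) as a WITNESS OF SURJECTIVITY only — no size letter on `H`
    (H : (Fin (constrCardB (lamBondsSeq (maxDomT ν.M₁ Z) k) k) → lieSU (Fin 2)) → PBond (F.P Kt) 0 → lieSU (Fin 2))
    (hHinv : ∀ v, fderiv ℝ (msChartB F 2 Kt k (lamBondsSeq (maxDomT ν.M₁ Z) k) (avgFamily (avOfRecord F 2 Kt) (qsstarGIter0 k (ext Vk))) U₀) 0 (H v) = v)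
    -- hrow: the PER-ROW ℓ¹ PREIMAGE LETTER for the positive-level rows (ρ6b: the right inverse's size enters one constraint row at a time)
    {B₁ : ℝ} (hB1 : 0 ≤ B₁)
    (hrow : ∀ i : Fin (constrCardB (lamBondsSeq (maxDomT ν.M₁ Z) k) k), 1 ≤ ((((constrEnumB (lamBondsSeq (maxDomT ν.M₁ Z) k) k).symm i).1 : ℕ)) → ∀ ξ : lieSU (Fin 2),
      ∃ x : PBond (F.P Kt) 0 → lieSU (Fin 2), fderiv ℝ (msChartB F 2 Kt k (lamBondsSeq (maxDomT ν.M₁ Z) k) (avgFamily (avOfRecord F 2 Kt) (qsstarGIter0 k (ext Vk))) U₀) 0 x = Pi.single i ξ ∧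
        ∑ b, ‖(x b : Matrix (Fin 2) (Fin 2) ℂ)‖ ≤ B₁ * ‖ξ‖)
    -- hM₂: the chart curvature at `U₀` in ℓ¹ CURRENCY (displayed): the constraint-ℓ¹ size of `D²Ψ(0)(w,w)` against the bond-ℓ² size of `w` (ρ6: no explicit constraint count in (μ))
    {M₂ : ℝ}
    (hM₂1 : ∀ w, ∑ c, ‖fderiv ℝ (fderiv ℝ (msChartB F 2 Kt k (lamBondsSeq (maxDomT ν.M₁ Z) k) (avgFamily (avOfRecord F 2 Kt) (qsstarGIter0 k (ext Vk))) U₀)) 0 w w c‖ ≤ M₂ * ∑ b, ‖w b‖ ^ 2)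
    -- the (K) LETTER (ρ6b: the chart velocity's bond-ℓ² size DISPLAYED, not derived from a per-bond bound × support — no explicit bond count in (K))
    {K₂ : ℝ}
    (hK2 : ∀ X : GaugeSlice (pts k Λ) T E3, Real.sqrt (∑ b, ‖fderiv ℝ Xf 0 X b‖ ^ 2) ≤ K₂ * ‖X‖) :
    ∃ (Ψ₂ : (PBond (F.P Kt) 0 → lieSU (Fin 2)) →L[ℝ] (PBond (F.P Kt) 0 → lieSU (Fin 2)) →L[ℝ] (Fin (constrCardB (lamBondsSeq (maxDomT ν.M₁ Z) k) k) → lieSU (Fin 2)))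
      (lam : (Fin (constrCardB (lamBondsSeq (maxDomT ν.M₁ Z) k) k) → lieSU (Fin 2)) →L[ℝ] ℝ)
      (p : Seminorm ℝ (PBond (F.P Kt) 0 → lieSU (Fin 2))),
      HasFDerivAt (fun Y => fderiv ℝ (msChartB F 2 Kt k (lamBondsSeq (maxDomT ν.M₁ Z) k) (avgFamily (avOfRecord F 2 Kt) (qsstarGIter0 k (ext Vk))) U₀) Y) Ψ₂ 0 ∧
      (∀ᶠ Y in 𝓝 (0 : PBond (F.P Kt) 0 → lieSU (Fin 2)), DifferentiableAt ℝ (msChartB F 2 Kt k (lamBondsSeq (maxDomT ν.M₁ Z) k) (avgFamily (avOfRecord F 2 Kt) (qsstarGIter0 k (ext Vk))) U₀) Y) ∧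
      fderiv ℝ (fun Y : PBond (F.P Kt) 0 → lieSU (Fin 2) => wilsonAction4 (expChart U₀ Y)) 0 = lam.comp (fderiv ℝ (msChartB F 2 Kt k (lamBondsSeq (maxDomT ν.M₁ Z) k) (avgFamily (avOfRecord F 2 Kt) (qsstarGIter0 k (ext Vk))) U₀) 0) ∧
      (∀ Y : PBond (F.P Kt) 0 → lieSU (Fin 2), ∑ b, ‖(Y b : Matrix (Fin 2) (Fin 2) ℂ)‖ ^ 2 ≤ p Y ^ 2) ∧
      ∀ X : GaugeSlice (pts k Λ) T E3,
        lam (Ψ₂ (fderiv ℝ Xf 0 X) (fderiv ℝ Xf 0 X))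
            ≤ (2 * (((F.P Kt).d : ℝ) - 1) * εP * B₁ * M₂) * p (fderiv ℝ Xf 0 X) ^ 2 ∧
        p (fderiv ℝ Xf 0 X) ≤ K₂ * ‖X‖ := by
  classical
  -- ### the junction's seminorm `p := bond-ℓ²(HS)` and its letters (as in (χ)_N)
  let p : Seminorm ℝ (PBond (F.P Kt) 0 → lieSU (Fin 2)) :=
    (normSeminorm ℝ (PiLp 2 (fun _ : PBond (F.P Kt) 0 => lieSU (Fin 2)))).comp (WithLp.linearEquiv 2 ℝ (PBond (F.P Kt) 0 → lieSU (Fin 2))).symm.toLinearMap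
  have hp : ∀ Y : PBond (F.P Kt) 0 → lieSU (Fin 2), ∑ b, ‖(Y b : Matrix (Fin 2) (Fin 2) ℂ)‖ ^ 2 ≤ p Y ^ 2 := fun Y => sum_opNorm_sq_le_l2Seminorm_sq Y
  have hpsq : ∀ Y : PBond (F.P Kt) 0 → lieSU (Fin 2), p Y ^ 2 = ∑ b, ‖Y b‖ ^ 2 := fun Y => l2Seminorm_sq Y
  have hpY : ∀ Y : PBond (F.P Kt) 0 → lieSU (Fin 2), p Y = Real.sqrt (∑ b, ‖Y b‖ ^ 2) := fun Y => l2Seminorm_apply Y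
  -- ### fibre, regularity, multiplier
  have hUfib : AgreeOnB (lamBondsSeq (maxDomT ν.M₁ Z) k) (avgFamily (avOfRecord F 2 Kt) U₀) (avgFamily (avOfRecord F 2 Kt) (qsstarGIter0 k (ext Vk))) := hmin0.2.1
  obtain ⟨-, hstrict, ⟨hΨ₂, hΨd⟩, -⟩ := chartLetters_msChart_lamBondsSeq_of_isMinimizer_of_class ν Kt Z hkK hM4 hdiv hε hsbU hερ hmin0
  have hΨ : DifferentiableAt ℝ (msChartB F 2 Kt k (lamBondsSeq (maxDomT ν.M₁ Z) k) (avgFamily (avOfRecord F 2 Kt) (qsstarGIter0 k (ext Vk))) U₀) 0 := hstrict.hasFDerivAt.differentiableAt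
  have hsurj : Function.Surjective (fderiv ℝ (msChartB F 2 Kt k (lamBondsSeq (maxDomT ν.M₁ Z) k) (avgFamily (avOfRecord F 2 Kt) (qsstarGIter0 k (ext Vk))) U₀) 0) := fun v => ⟨H v, hHinv v⟩
  obtain ⟨lam, hlam⟩ := exists_lam_msChart_lamBondsSeq_of_isMinimizer_regMSCoPOfRecord_of_class ν Kt Z hkK hM4 hdiv hε hsbU hερ hmin0 hsurj
  -- ### the multiplier bound from the PLAQUETTE-SMALL current factor on the range of `H`
  have hd1 : 0 ≤ ((F.P Kt).d : ℝ) - 1 := by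
    have h1 : (1 : ℝ) ≤ (F.P Kt).d := by exact_mod_cast (F.P Kt).hd
    linarith
  have hlamv : ∀ v : Fin (constrCardB (lamBondsSeq (maxDomT ν.M₁ Z) k) k) → lieSU (Fin 2),
      (∀ (c : PBond (F.P Kt) 0) (hc : c ∈ ((lamBondsSeq (maxDomT ν.M₁ Z) k : BDetSet (F.P Kt)) 0)),
        v (constrEnumB (lamBondsSeq (maxDomT ν.M₁ Z) k : BDetSet (F.P Kt)) k ⟨⟨0, Nat.succ_pos k⟩, c, hc⟩) = 0) →
      |lam v| ≤ (2 * (((F.P Kt).d : ℝ) - 1) * εP * B₁) * ∑ i, ‖v i‖ := by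
    intro v hv
    -- one row at a time: `λ` is linear and `v = Σ_i e_i v_i`
    have hterm : ∀ i, |lam (Pi.single i (v i))| ≤ (2 * (((F.P Kt).d : ℝ) - 1) * εP * B₁) * ‖v i‖ := by
      intro i
      obtain ⟨⟨⟨j, hj⟩, c, hc⟩, rfl⟩ : ∃ s, i = constrEnumB (lamBondsSeq (maxDomT ν.M₁ Z) k : BDetSet (F.P Kt)) k s := ⟨_, ((constrEnumB (lamBondsSeq (maxDomT ν.M₁ Z) k : BDetSet (F.P Kt)) k).apply_symm_apply i).symm⟩
      rcases Nat.eq_zero_or_pos j with rfl | hjpos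
      · -- a level-0 row: the datum vanishes there
        rw [hv c hc, Pi.single_zero, map_zero, abs_zero]
        positivity
      · -- a positive-level row: any preimage of the one-row datum vanishes off Ω₁(Z) (exact Γ₀ layer), so the plaquette-small current bounds the term
        have hlev : 1 ≤ ((((constrEnumB (lamBondsSeq (maxDomT ν.M₁ Z) k) k).symm (constrEnumB (lamBondsSeq (maxDomT ν.M₁ Z) k : BDetSet (F.P Kt)) k ⟨⟨j, hj⟩, c, hc⟩)).1 : ℕ)) := by
          rw [Equiv.symm_apply_apply]; exact hjpos
        obtain ⟨x, hx, hxB⟩ := hrow _ hlev (v (constrEnumB (lamBondsSeq (maxDomT ν.M₁ Z) k : BDetSet (F.P Kt)) k ⟨⟨j, hj⟩, c, hc⟩))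
        have hxsupp : ∀ b ∉ S₀, x b = 0 := by
          intro b hb
          have hbm : b ∈ ((lamBondsSeq (maxDomT ν.M₁ Z) k : BDetSet (F.P Kt)) 0) := hS₀ b hb
          have h1 := fderiv_msChartB_apply_levelZero hUfib hΨ b hbm x
          have hne : constrEnumB (lamBondsSeq (maxDomT ν.M₁ Z) k : BDetSet (F.P Kt)) k ⟨⟨0, Nat.succ_pos k⟩, b, hbm⟩ ≠ constrEnumB (lamBondsSeq (maxDomT ν.M₁ Z) k : BDetSet (F.P Kt)) k ⟨⟨j, hj⟩, c, hc⟩ := by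
            intro h
            have h' := congrArg (fun s : ConstrSetB (lamBondsSeq (maxDomT ν.M₁ Z) k : BDetSet (F.P Kt)) k => ((s.1 : ℕ))) ((constrEnumB (lamBondsSeq (maxDomT ν.M₁ Z) k : BDetSet (F.P Kt)) k).injective h)
            simp only at h'
            omega
          rw [← h1, hx, Pi.single_eq_of_ne hne]
        have h1 : lam (Pi.single (constrEnumB (lamBondsSeq (maxDomT ν.M₁ Z) k : BDetSet (F.P Kt)) k ⟨⟨j, hj⟩, c, hc⟩) (v (constrEnumB (lamBondsSeq (maxDomT ν.M₁ Z) k : BDetSet (F.P Kt)) k ⟨⟨j, hj⟩, c, hc⟩)))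
            = fderiv ℝ (fun Y : PBond (F.P Kt) 0 → lieSU (Fin 2) => wilsonAction4 (expChart U₀ Y)) 0 x := by
          rw [← hx, hlam, ContinuousLinearMap.comp_apply]
        rw [h1]
        calc |fderiv ℝ (fun Y : PBond (F.P Kt) 0 → lieSU (Fin 2) => wilsonAction4 (expChart U₀ Y)) 0 x|
            ≤ 2 * (((F.P Kt).d : ℝ) - 1) * εP * ∑ b : PBond (F.P Kt) 0, ‖(x b : Matrix (Fin 2) (Fin 2) ℂ)‖ :=
              abs_fderiv_wilsonAction4_expChart_apply_le_of_plaqSmall_supp S₀ U₀ hP x hxsupp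
          _ ≤ 2 * (((F.P Kt).d : ℝ) - 1) * εP * (B₁ * ‖v (constrEnumB (lamBondsSeq (maxDomT ν.M₁ Z) k : BDetSet (F.P Kt)) k ⟨⟨j, hj⟩, c, hc⟩)‖) := mul_le_mul_of_nonneg_left hxB (by positivity)
          _ = (2 * (((F.P Kt).d : ℝ) - 1) * εP * B₁) * ‖v (constrEnumB (lamBondsSeq (maxDomT ν.M₁ Z) k : BDetSet (F.P Kt)) k ⟨⟨j, hj⟩, c, hc⟩)‖ := by ring
    calc |lam v| = |∑ i, lam (Pi.single i (v i))| := by rw [← map_sum, Finset.univ_sum_single]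
      _ ≤ ∑ i, |lam (Pi.single i (v i))| := Finset.abs_sum_le_sum_abs _ _
      _ ≤ ∑ i, (2 * (((F.P Kt).d : ℝ) - 1) * εP * B₁) * ‖v i‖ := Finset.sum_le_sum fun i _ => hterm i
      _ = (2 * (((F.P Kt).d : ℝ) - 1) * εP * B₁) * ∑ i, ‖v i‖ := by rw [Finset.mul_sum]
  -- ### assemble
  refine ⟨fderiv ℝ (fderiv ℝ (msChartB F 2 Kt k (lamBondsSeq (maxDomT ν.M₁ Z) k) (avgFamily (avOfRecord F 2 Kt) (qsstarGIter0 k (ext Vk))) U₀)) 0, lam, p, hΨ₂, hΨd, hlam, hp, fun X => ⟨?_, ?_⟩⟩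
  · -- (μ): multiplier bound (ℓ¹ on the constraints) × ℓ¹-curvature letter × `Σ_b ‖w_b‖² = p(w)²`
    have hc0 : 0 ≤ 2 * (((F.P Kt).d : ℝ) - 1) * εP * B₁ := by positivity
    calc lam (fderiv ℝ (fderiv ℝ (msChartB F 2 Kt k (lamBondsSeq (maxDomT ν.M₁ Z) k) (avgFamily (avOfRecord F 2 Kt) (qsstarGIter0 k (ext Vk))) U₀)) 0 (fderiv ℝ Xf 0 X) (fderiv ℝ Xf 0 X))
        ≤ |lam (fderiv ℝ (fderiv ℝ (msChartB F 2 Kt k (lamBondsSeq (maxDomT ν.M₁ Z) k) (avgFamily (avOfRecord F 2 Kt) (qsstarGIter0 k (ext Vk))) U₀)) 0 (fderiv ℝ Xf 0 X) (fderiv ℝ Xf 0 X))| := le_abs_self _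
      _ ≤ (2 * (((F.P Kt).d : ℝ) - 1) * εP * B₁) * ∑ c, ‖fderiv ℝ (fderiv ℝ (msChartB F 2 Kt k (lamBondsSeq (maxDomT ν.M₁ Z) k) (avgFamily (avOfRecord F 2 Kt) (qsstarGIter0 k (ext Vk))) U₀)) 0 (fderiv ℝ Xf 0 X) (fderiv ℝ Xf 0 X) c‖ :=
          hlamv _ (fun c hc => fderiv_fderiv_msChartB_apply_levelZero hUfib hΨd hΨ₂.differentiableAt c hc _ _)
      _ ≤ (2 * (((F.P Kt).d : ℝ) - 1) * εP * B₁) * (M₂ * ∑ b, ‖fderiv ℝ Xf 0 X b‖ ^ 2) := mul_le_mul_of_nonneg_left (hM₂1 _) hc0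
      _ = (2 * (((F.P Kt).d : ℝ) - 1) * εP * B₁ * M₂) * p (fderiv ℝ Xf 0 X) ^ 2 := by rw [hpsq]; ring
  · -- (K): the displayed ℓ² letter, read through `p(Y) = √(Σ_b ‖Y_b‖²)`
    rw [hpY]
    exact hK2 X

end

section
variable {F : T4Family}

/-- ★★★ **THE CHART HALF OF THE (WD) PACKAGE, (μ) KEYED ON PER-ROW ℓ¹ PREIMAGES, CONSTANTS PER HEIGHT BEFORE THE INSTANCE** — ρ6's
`N12DirectChartPackageOfClassL1.exists_hWD_chartHalf_of_class_uniform_l1` VERBATIM except, in the ∀-body: the right inverse carries no size letter and the per-row ℓ¹ preimage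
letter `∀ i, 1 ≤ level i → ∀ ξ, ∃ x, DΨ(0) x = e_i ξ ∧ Σ_b ‖↑x_b‖_op ≤ B₁‖ξ‖` takes the place of `hHB1`, and the ℓ² velocity letter `∀ X, √(Σ_b ‖(X_f′X)_b‖²) ≤ K₂‖X‖` the place of
`(R, 𝓐₀, hKb, hsupp)` (every `(12𝓐₀/R)·√#{…}` of ρ6 reads `K₂`).  This ∀-body IS the chart-half letter `hhalf` a consumer displays; its
family form is `N12DirectChartPackageOfClassRowL1FamilyB.exists_hWD_chartHalf_of_class_uniform_rowl1_family`.  Proof: ρ6 §2's over §1.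
[cite: Balaban1989LargeFieldII, p.357, (1.7) p.358, (1.12)–(1.13) p.359; Balaban1985Variational, (45) p.285, (81)–(83) p.290, (172) p.305; Balaban1988Convergent, (2.2) p.255, (2.10)–(2.13) pp.256–257] -/
theorem exists_hWD_chartHalf_of_class_uniform_rowl1 (Kt : ℕ) (h0 : 0 < (F.P Kt).d) {k : ℕ} (hk0 : 0 < k) (hk : k ≤ (F.P Kt).m + (F.P Kt).K) :
    ∃ C ρ Kτ ρτ ρ'' : ℝ, 0 ≤ C ∧ 0 < ρ ∧ 0 ≤ Kτ ∧ 0 < ρτ ∧ 0 < ρ'' ∧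
      ∀ (ν : Node00.Stage7Numerics) (Z Λ : Set (Site (F.P Kt) 0)) (T : Finset (PBond (F.P Kt) k)) (lo hi : Fin (F.P Kt).d → ℤ),
      (∀ κ, ((((hi κ - lo κ + 1).toNat + 3 : ℕ) : ℤ)) ≤ (F.P Kt).sitesPerDir k) →
      (∀ (ν' : Fin (F.P Kt).d), ∀ z ∈ box (fun κ => (hi κ - lo κ + 1).toNat + 3) (fun κ => lo κ - 2),
        (castSite z : Site (F.P Kt) k) ∈ pts k (maxDomT ν.M₁ Z k) ∧ (castSite z : Site (F.P Kt) k).shift ⟨0, h0⟩ ∈ pts k (maxDomT ν.M₁ Z k) ∧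
          (castSite z : Site (F.P Kt) k).shift ν' ∈ pts k (maxDomT ν.M₁ Z k)) →
      k + 1 ≤ (F.P Kt).m + (F.P Kt).K → 4 * (F.P Kt).L ≤ ν.M₁ → side (F.P Kt).L ν.M₁ k ∣ (F.P Kt).sitesPerDir 0 → 0 ≤ ν.εreg →
      6 * ((((F.P Kt).d - 1 : ℕ)) : ℝ) * (F.P Kt).L * ν.εreg ≤ ρ'' →
      ∀ (ext : GaugeField (F.P Kt) k SU2 → GaugeField (F.P Kt) k SU2) (Vk : GaugeField (F.P Kt) k SU2),
      ∀ (U₀ : GaugeField (F.P Kt) 0 SU2) (Xf : GaugeSlice (pts k Λ) T E3 → PBond (F.P Kt) 0 → lieSU (Fin 2)),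
      IsMinimizerB (Node00.avOfRecord F 2 Kt) (Node00.regMSCoPOfRecord F 2 ν Kt k (maxDomT ν.M₁ Z)) (lamBondsSeq (maxDomT ν.M₁ Z) k)
        (avgFamily (Node00.avOfRecord F 2 Kt) (qsstarGIter0 k (ext Vk))) U₀ →
      ∀ (S₀ : Set (PBond (F.P Kt) 0)), (∀ b ∉ S₀, b ∈ lamBondsSeq (maxDomT ν.M₁ Z) k 0) → ∀ ⦃εP : ℝ⦄, 0 ≤ εP →
      (∀ p : Plaq (F.P Kt) 0, ((⟨p.src, p.μ⟩ : PBond (F.P Kt) 0) ∈ S₀ ∨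
          (⟨p.src.shift p.μ, p.ν⟩ : PBond (F.P Kt) 0) ∈ S₀ ∨
          (⟨p.src.shift p.ν, p.μ⟩ : PBond (F.P Kt) 0) ∈ S₀ ∨
          (⟨p.src, p.ν⟩ : PBond (F.P Kt) 0) ∈ S₀) →
        ‖((GaugeField.plaqHol U₀ p : SU2) : Matrix (Fin 2) (Fin 2) ℂ) - 1‖ ≤ εP) →
      ∀ (H : (Fin (constrCardB (lamBondsSeq (maxDomT ν.M₁ Z) k) k) → lieSU (Fin 2)) → PBond (F.P Kt) 0 → lieSU (Fin 2)),
      (∀ v, fderiv ℝ (msChartB F 2 Kt k (lamBondsSeq (maxDomT ν.M₁ Z) k) (avgFamily (avOfRecord F 2 Kt) (qsstarGIter0 k (ext Vk))) U₀) 0 (H v) = v) →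
      ∀ ⦃B₁ : ℝ⦄, 0 ≤ B₁ →
      (∀ i : Fin (constrCardB (lamBondsSeq (maxDomT ν.M₁ Z) k) k), 1 ≤ ((((constrEnumB (lamBondsSeq (maxDomT ν.M₁ Z) k) k).symm i).1 : ℕ)) → ∀ ξ : lieSU (Fin 2),
        ∃ x : PBond (F.P Kt) 0 → lieSU (Fin 2), fderiv ℝ (msChartB F 2 Kt k (lamBondsSeq (maxDomT ν.M₁ Z) k) (avgFamily (avOfRecord F 2 Kt) (qsstarGIter0 k (ext Vk))) U₀) 0 x = Pi.single i ξ ∧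
          ∑ b, ‖(x b : Matrix (Fin 2) (Fin 2) ℂ)‖ ≤ B₁ * ‖ξ‖) →
      ∀ ⦃M₂ : ℝ⦄, (∀ w, ∑ c, ‖fderiv ℝ (fderiv ℝ (msChartB F 2 Kt k (lamBondsSeq (maxDomT ν.M₁ Z) k) (avgFamily (avOfRecord F 2 Kt) (qsstarGIter0 k (ext Vk))) U₀)) 0 w w c‖ ≤ M₂ * ∑ b, ‖w b‖ ^ 2) →
      Xf 0 = 0 → ContDiffAt ℝ 2 Xf 0 →
      (∀ᶠ Y in 𝓝 (0 : GaugeSlice (pts k Λ) T E3),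
        IsMinimizerB (Node00.avOfRecord F 2 Kt) (Node00.regMSCoPOfRecord F 2 ν Kt k (maxDomT ν.M₁ Z)) (lamBondsSeq (maxDomT ν.M₁ Z) k)
          (avgFamily (Node00.avOfRecord F 2 Kt) (qsstarGIter0 k (expMul su2Chart (ιA (pts k Λ) T Y) (ext Vk)))) (expChart U₀ (Xf Y))) →
      ∀ ⦃K₂ : ℝ⦄, (∀ X : GaugeSlice (pts k Λ) T E3, Real.sqrt (∑ b, ‖fderiv ℝ Xf 0 X b‖ ^ 2) ≤ K₂ * ‖X‖) →
      ∀ (W : Finset (Plaq (F.P Kt) 0)),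
      (∀ q : Plaq (F.P Kt) 0, q.src ∈ ((box (fun κ => (F.P Kt).L ^ k * ((hi κ - lo κ + 1).toNat + 3 + 1) - 1) (fun κ => ((F.P Kt).L : ℤ) ^ k * (lo κ - 2))).image
          (fun z => (castSite z : Site (F.P Kt) 0))) → q ∈ W) →
      ∀ ⦃δW : ℝ⦄, 0 < δW → δW < ρ → δW < ρτ →
      (∀ (ν' : Fin (F.P Kt).d), ∀ z ∈ box (fun κ => (hi κ - lo κ + 1).toNat + 3) (fun κ => lo κ - 2), ∀ b₀ : PBond (F.P Kt) 0,
        (b₀ ∈ feeds k (⟨(castSite z : Site (F.P Kt) k), ⟨0, h0⟩⟩ : PBond (F.P Kt) k) ∨ b₀ ∈ feeds k (⟨((castSite z : Site (F.P Kt) k)).shift ⟨0, h0⟩, ν'⟩ : PBond (F.P Kt) k)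
        ∨ b₀ ∈ feeds k (⟨((castSite z : Site (F.P Kt) k)).shift ν', ⟨0, h0⟩⟩ : PBond (F.P Kt) k) ∨ b₀ ∈ feeds k (⟨(castSite z : Site (F.P Kt) k), ν'⟩ : PBond (F.P Kt) k)) →
        ‖((U₀ b₀ : SU2) : Matrix (Fin 2) (Fin 2) ℂ) - 1‖ ≤ δW) →
      ∃ (Ψ₂ : (PBond (F.P Kt) 0 → lieSU (Fin 2)) →L[ℝ] (PBond (F.P Kt) 0 → lieSU (Fin 2)) →L[ℝ] (Fin (constrCardB (lamBondsSeq (maxDomT ν.M₁ Z) k) k) → lieSU (Fin 2)))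
        (lam : (Fin (constrCardB (lamBondsSeq (maxDomT ν.M₁ Z) k) k) → lieSU (Fin 2)) →L[ℝ] ℝ)
        (p : Seminorm ℝ (PBond (F.P Kt) 0 → lieSU (Fin 2))),
        HasFDerivAt (fun Y => fderiv ℝ (msChartB F 2 Kt k (lamBondsSeq (maxDomT ν.M₁ Z) k) (avgFamily (avOfRecord F 2 Kt) (qsstarGIter0 k (ext Vk))) U₀) Y) Ψ₂ 0 ∧
        (∀ᶠ Y in 𝓝 (0 : PBond (F.P Kt) 0 → lieSU (Fin 2)), DifferentiableAt ℝ (msChartB F 2 Kt k (lamBondsSeq (maxDomT ν.M₁ Z) k) (avgFamily (avOfRecord F 2 Kt) (qsstarGIter0 k (ext Vk))) U₀) Y) ∧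
        fderiv ℝ (fun Y : PBond (F.P Kt) 0 → lieSU (Fin 2) => wilsonAction4 (expChart U₀ Y)) 0 = lam.comp (fderiv ℝ (msChartB F 2 Kt k (lamBondsSeq (maxDomT ν.M₁ Z) k) (avgFamily (avOfRecord F 2 Kt) (qsstarGIter0 k (ext Vk))) U₀) 0) ∧
        (∀ Y : PBond (F.P Kt) 0 → lieSU (Fin 2), ∑ b, ‖(Y b : Matrix (Fin 2) (Fin 2) ℂ)‖ ^ 2 ≤ p Y ^ 2) ∧
        ∀ X : GaugeSlice (pts k Λ) T E3,
          lam (Ψ₂ (fderiv ℝ Xf 0 X) (fderiv ℝ Xf 0 X))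
              ≤ (2 * (((F.P Kt).d : ℝ) - 1) * εP * B₁ * M₂) * p (fderiv ℝ Xf 0 X) ^ 2 ∧
          p (fderiv ℝ Xf 0 X) ≤ K₂ * ‖X‖ ∧
          (((F.P Kt).L : ℝ) ^ (F.P Kt).d) ^ k / ((((F.P Kt).L : ℝ)) ^ 2 * ((F.P Kt).L : ℝ) ^ 2) ^ k / 2 * (∑ z ∈ box (fun κ => (hi κ - lo κ + 1).toNat + 3) (fun κ => lo κ - 2), ∑ μ : Fin (F.P Kt).d, ∑ a : Fin 3, curl (fun b => ιA (pts k Λ) T X (⟨castSite b.1, b.2⟩ : PBond (F.P Kt) k) a) z ⟨0, h0⟩ μ ^ 2)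
              - (((F.P Kt).L : ℝ) ^ (F.P Kt).d) ^ k / ((((F.P Kt).L : ℝ)) ^ 2 * ((F.P Kt).L : ℝ) ^ 2) ^ k * (8 * (((F.P Kt).d : ℝ) + 1) * (2 * (Kτ + 1) * δW) + 8 * ((F.P Kt).d : ℝ) * (((box (fun κ => (hi κ - lo κ + 1).toNat + 3) (fun κ => lo κ - 2)).image (fun z => (castSite z : Site (F.P Kt) k))).card : ℝ) * (C * δW * K₂) ^ 2) * ‖X‖ ^ 2
            ≤ ((Fintype.card (Fin 2) : ℝ)⁻¹ • ∑ p ∈ W, (innerSL ℝ (E := lieSU (Fin 2))).bilinearComp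
              (ContinuousLinearMap.proj (R := ℝ) (φ := fun _ : PBond (F.P Kt) 0 => lieSU (Fin 2)) (⟨p.src, p.μ⟩ : PBond (F.P Kt) 0) + ContinuousLinearMap.proj (R := ℝ) (φ := fun _ : PBond (F.P Kt) 0 => lieSU (Fin 2)) (⟨p.src.shift p.μ, p.ν⟩ : PBond (F.P Kt) 0)
                - ContinuousLinearMap.proj (R := ℝ) (φ := fun _ : PBond (F.P Kt) 0 => lieSU (Fin 2)) (⟨p.src.shift p.ν, p.μ⟩ : PBond (F.P Kt) 0) - ContinuousLinearMap.proj (R := ℝ) (φ := fun _ : PBond (F.P Kt) 0 => lieSU (Fin 2)) (⟨p.src, p.ν⟩ : PBond (F.P Kt) 0) : (PBond (F.P Kt) 0 → lieSU (Fin 2)) →L[ℝ] lieSU (Fin 2))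
              (ContinuousLinearMap.proj (R := ℝ) (φ := fun _ : PBond (F.P Kt) 0 => lieSU (Fin 2)) (⟨p.src, p.μ⟩ : PBond (F.P Kt) 0) + ContinuousLinearMap.proj (R := ℝ) (φ := fun _ : PBond (F.P Kt) 0 => lieSU (Fin 2)) (⟨p.src.shift p.μ, p.ν⟩ : PBond (F.P Kt) 0)
                - ContinuousLinearMap.proj (R := ℝ) (φ := fun _ : PBond (F.P Kt) 0 => lieSU (Fin 2)) (⟨p.src.shift p.ν, p.μ⟩ : PBond (F.P Kt) 0) - ContinuousLinearMap.proj (R := ℝ) (φ := fun _ : PBond (F.P Kt) 0 => lieSU (Fin 2)) (⟨p.src, p.ν⟩ : PBond (F.P Kt) 0) : (PBond (F.P Kt) 0 → lieSU (Fin 2)) →L[ℝ] lieSU (Fin 2))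
              : (PBond (F.P Kt) 0 → lieSU (Fin 2)) →L[ℝ] (PBond (F.P Kt) 0 → lieSU (Fin 2)) →L[ℝ] ℝ) (fderiv ℝ Xf 0 X) (fderiv ℝ Xf 0 X) := by
  classical
  -- ### the `linAvg` iterate and the explicit junction seminorm (for the velocity-form clause's constants)
  let Q : (i : ℕ) → (PBond (F.P Kt) 0 → Matrix (Fin 2) (Fin 2) ℂ) → PBond (F.P Kt) i → Matrix (Fin 2) (Fin 2) ℂ := fun i =>
    Nat.rec (motive := fun i => (PBond (F.P Kt) 0 → Matrix (Fin 2) (Fin 2) ℂ) → PBond (F.P Kt) i → Matrix (Fin 2) (Fin 2) ℂ)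
      (fun Y => Y) (fun _ q Y c => linAvg (q Y) c) i
  have hQ0 : ∀ Y, Q 0 Y = Y := fun Y => rfl
  have hQs : ∀ (i : ℕ) (Y : PBond (F.P Kt) 0 → Matrix (Fin 2) (Fin 2) ℂ) (c : PBond (F.P Kt) (i + 1)), Q (i + 1) Y c = linAvg (Q i Y) c :=
    fun i Y c => rfl
  let p₀ : Seminorm ℝ (PBond (F.P Kt) 0 → lieSU (Fin 2)) :=
    (normSeminorm ℝ (PiLp 2 (fun _ : PBond (F.P Kt) 0 => lieSU (Fin 2)))).comp (WithLp.linearEquiv 2 ℝ (PBond (F.P Kt) 0 → lieSU (Fin 2))).symm.toLinearMap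
  have hp₀ : ∀ Y : PBond (F.P Kt) 0 → lieSU (Fin 2), ∑ b, ‖(Y b : Matrix (Fin 2) (Fin 2) ℂ)‖ ^ 2 ≤ p₀ Y ^ 2 := fun Y => sum_opNorm_sq_le_l2Seminorm_sq Y
  -- ### the per-height constants
  obtain ⟨C, ρ, hC, hρ, hδ2⟩ := exists_delta2_letter_component (F := F) (N := 2) (K := Kt) k Q hQ0 hQs p₀ hp₀
  obtain ⟨Kτ, ρτ, hKτ, hρτ, htw⟩ := exists_twistSize_of_nearFlat_feeds (F := F) (N := 2) Kt k
  obtain ⟨_, ρ'', _, hρ'', hsbU, _⟩ := exists_uniform_chartCurvatureB_sq_bound (F := F) (N := 2) (K := Kt) k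
  refine ⟨C, ρ, Kτ, ρτ, ρ'', hC, hρ, hKτ, hρτ, hρ'', ?_⟩
  intro ν Z Λ T lo hi hbox hΩw hkK hM4 hdiv hε hερ ext Vk U₀ Xf hmin0 S₀ hS₀ εP hεP0 hP H hHinv B₁ hB1 hrow M₂ hM₂1 hX₀ hXc hmin K₂ hK2 W hWin δW hδW0 hδWρ hδWτ hδW
  -- ### the chart rows (P1)
  obtain ⟨Ψ₂, lam, p, hΨ₂, hΨd, hlam, hp, hrows⟩ :=
    chartRows_direct_of_class_rowl1 ν Kt hk0 Z Λ T ext Vk U₀ Xf hmin0 hkK hM4 hdiv hε hsbU hερ S₀ hS₀ hεP0 hP H hHinv hB1 hrow hM₂1 hK2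
  refine ⟨Ψ₂, lam, p, hΨ₂, hΨd, hlam, hp, fun X => ⟨(hrows X).1, (hrows X).2, ?_⟩⟩
  -- ### the velocity-form Federbush clause: region letters discharged by the block tower of the box (as p646479 §1)
  have hUfib : AgreeOnB (lamBondsSeq (maxDomT ν.M₁ Z) k) (avgFamily (avOfRecord F 2 Kt) U₀) (avgFamily (avOfRecord F 2 Kt) (qsstarGIter0 k (ext Vk))) := hmin0.2.1
  let Sset : (i : ℕ) → Finset (Site (F.P Kt) i) := fun i =>
    (box (fun κ => (F.P Kt).L ^ (k - i) * (((hi κ - lo κ + 1).toNat + 3) + 1) - 1) (fun κ => ((F.P Kt).L : ℤ) ^ (k - i) * (lo κ - 2))).image (fun z => (castSite z : Site (F.P Kt) i))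
  have hSk : Sset k = (box (fun κ => (hi κ - lo κ + 1).toNat + 3) (fun κ => lo κ - 2)).image (fun z => (castSite z : Site (F.P Kt) k)) := by
    simp only [Sset, Nat.sub_self, pow_zero, one_mul, Nat.add_sub_cancel]
  have hwin : ∀ z ∈ box (fun κ => (hi κ - lo κ + 1).toNat + 3) (fun κ => lo κ - 2), (castSite z : Site (F.P Kt) k) ∈ Sset k := fun z hz => by
    rw [hSk]
    exact Finset.mem_image_of_mem _ hz
  have hS : ∀ (ν' : Fin (F.P Kt).d), (⟨0, h0⟩ : Fin (F.P Kt).d) ≠ ν' → ∀ i, i < k → ∀ y ∈ Sset (i + 1), ∀ (r : Fin (F.P Kt).d → Fin (F.P Kt).L) (s t : ℕ),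
      s < (F.P Kt).L → t < (F.P Kt).L → runSite (runSite (Site.blockSite y r) ⟨0, h0⟩ s) ν' t ∈ Sset i := by
    intro ν' hν i hi y hy r s t hs ht
    exact runSite_runSite_blockSite_mem_tower h0 (lt_of_lt_of_le hi hk) hν hi hy r hs ht
  have hΩk : ∀ (ν' : Fin (F.P Kt).d), ∀ s ∈ Sset k, s ∈ pts k (maxDomT ν.M₁ Z k) ∧ s.shift ⟨0, h0⟩ ∈ pts k (maxDomT ν.M₁ Z k) ∧ s.shift ν' ∈ pts k (maxDomT ν.M₁ Z k) := by
    intro ν' s hs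
    rw [hSk, Finset.mem_image] at hs
    obtain ⟨z, hz, rfl⟩ := hs
    exact hΩw ν' z hz
  have hW0 : ∀ q : Plaq (F.P Kt) 0, q.src ∈ Sset 0 → q ∈ W := fun q hq => hWin q (by simpa only [Sset, Nat.sub_zero] using hq)
  have hcons := hcons_of_plaqsInside_maxDomT h0 Z (Sset k) hΩk
  -- near-flatness on the feeds of the region's plaquette bonds, re-indexed through `S_k = castSite″ box`
  have hδW' : ∀ (ν' : Fin (F.P Kt).d), ∀ s ∈ Sset k, ∀ b₀ : PBond (F.P Kt) 0,
      (b₀ ∈ feeds k (⟨s, ⟨0, h0⟩⟩ : PBond (F.P Kt) k) ∨ b₀ ∈ feeds k (⟨(s).shift ⟨0, h0⟩, ν'⟩ : PBond (F.P Kt) k)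
        ∨ b₀ ∈ feeds k (⟨(s).shift ν', ⟨0, h0⟩⟩ : PBond (F.P Kt) k) ∨ b₀ ∈ feeds k (⟨s, ν'⟩ : PBond (F.P Kt) k)) →
      ‖((U₀ b₀ : SU 2) : Matrix (Fin 2) (Fin 2) ℂ) - 1‖ ≤ δW := by
    intro ν' s hs b₀ hb₀
    rw [hSk, Finset.mem_image] at hs
    obtain ⟨z, hz, rfl⟩ := hs
    exact hδW ν' z hz b₀ hb₀
  -- the twist size at the region's plaquette bonds from the tower near-flatness
  have htwb : ∀ (c : PBond (F.P Kt) k), c ∈ bondsOf (Bj ν.M₁ Z k k) →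
      (∀ b₀ ∈ feeds k c, ‖((U₀ b₀ : SU 2) : Matrix (Fin 2) (Fin 2) ℂ) - 1‖ ≤ δW) →
      ‖((avgFamily (avOfRecord F 2 Kt) (qsstarGIter0 k (ext Vk)) k c : SU 2) : Matrix (Fin 2) (Fin 2) ℂ) - 1‖ ≤ (2 * (Kτ + 1) * δW) / 2 := by
    intro c hc hloc
    have h := htw (lamBondsSeq (maxDomT ν.M₁ Z) k) (avgFamily (avOfRecord F 2 Kt) (qsstarGIter0 k (ext Vk))) U₀ hk hUfib c (by rw [lamBondsSeq_of_le _ _ le_rfl]; exact hc) hδW0.le hδWτ hloc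
    have h2 : Kτ * δW ≤ (2 * (Kτ + 1) * δW) / 2 := by nlinarith [hδW0.le]
    exact h.trans h2
  have hW' : ∀ (ν' : Fin (F.P Kt).d), ∀ s ∈ Sset k,
      ‖((avgFamily (avOfRecord F 2 Kt) (qsstarGIter0 k (ext Vk)) k ⟨s, ⟨0, h0⟩⟩ : SU 2) : Matrix (Fin 2) (Fin 2) ℂ) - 1‖ ≤ (2 * (Kτ + 1) * δW) / 2 ∧
      ‖((avgFamily (avOfRecord F 2 Kt) (qsstarGIter0 k (ext Vk)) k ⟨s.shift ⟨0, h0⟩, ν'⟩ : SU 2) : Matrix (Fin 2) (Fin 2) ℂ) - 1‖ ≤ (2 * (Kτ + 1) * δW) / 2 ∧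
      ‖((avgFamily (avOfRecord F 2 Kt) (qsstarGIter0 k (ext Vk)) k ⟨s.shift ν', ⟨0, h0⟩⟩ : SU 2) : Matrix (Fin 2) (Fin 2) ℂ) - 1‖ ≤ (2 * (Kτ + 1) * δW) / 2 ∧
      ‖((avgFamily (avOfRecord F 2 Kt) (qsstarGIter0 k (ext Vk)) k ⟨s, ν'⟩ : SU 2) : Matrix (Fin 2) (Fin 2) ℂ) - 1‖ ≤ (2 * (Kτ + 1) * δW) / 2 := by
    intro ν' s hs
    obtain ⟨h1, h2, h3, h4⟩ := hcons ν' s hs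
    exact ⟨htwb _ h1 fun b₀ hb₀ => hδW' ν' s hs b₀ (Or.inl hb₀), htwb _ h2 fun b₀ hb₀ => hδW' ν' s hs b₀ (Or.inr (Or.inl hb₀)),
      htwb _ h3 fun b₀ hb₀ => hδW' ν' s hs b₀ (Or.inr (Or.inr (Or.inl hb₀))), htwb _ h4 fun b₀ hb₀ => hδW' ν' s hs b₀ (Or.inr (Or.inr (Or.inr hb₀)))⟩
  have hτ : 0 < (2 * (Kτ + 1) * δW) := by positivity
  have hΨ : DifferentiableAt ℝ (msChartB F 2 Kt k (lamBondsSeq (maxDomT ν.M₁ Z) k) (avgFamily (avOfRecord F 2 Kt) (qsstarGIter0 k (ext Vk))) U₀) 0 :=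
    (chartLetters_msChart_lamBondsSeq_of_isMinimizer_of_class ν Kt Z hkK hM4 hdiv hε hsbU hερ hmin0).2.1.hasFDerivAt.differentiableAt
  have hX1 : HasFDerivAt Xf (fderiv ℝ Xf 0) 0 := (hXc.differentiableAt two_ne_zero).hasFDerivAt
  have hη0 : (0 : ℝ) < 1 / 2 := by norm_num
  have hη1 : (1 : ℝ) / 2 < 1 := by norm_num
  -- (K) for the explicit seminorm `p₀`
  have hK0 : ∀ X' : GaugeSlice (pts k Λ) T E3, p₀ (fderiv ℝ Xf 0 X') ≤ K₂ * ‖X'‖ := by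
    intro X'
    rw [show p₀ (fderiv ℝ Xf 0 X') = Real.sqrt (∑ b, ‖fderiv ℝ Xf 0 X' b‖ ^ 2) from l2Seminorm_apply _]
    exact hK2 X'
  -- the velocity-form clause at `η = 1∕2` (Pauli coordinates eliminated in term mode)
  have key := exists_lieSU2Coord.elim fun φ hφ =>
    hmX_federbush_window_of_delta2Component h0 hk Q hQ0 hQs p₀ hδ2 Z X (fun κ => lo κ - 2) hbox Sset hwin hS hφ hΩk (regMSCoPOfRecord F 2 ν Kt k (maxDomT ν.M₁ Z)) (ext Vk) U₀ hX₀ hmin hX1 hΨ hτ hW' W hW0 hδW0.le hδWρ hδW' hη0 hη1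
  -- arithmetic: `(C·δ_W·p₀(X_f′X))² ≤ (C·δ_W·Kc)²‖X‖²`, `|S_k|` of the statement = `(S_k).card`
  have hcard : ((Sset k).card : ℝ) = (((box (fun κ => (hi κ - lo κ + 1).toNat + 3) (fun κ => lo κ - 2)).image (fun z => (castSite z : Site (F.P Kt) k))).card : ℝ) := by rw [hSk]
  have hpK : (C * δW * p₀ (fderiv ℝ Xf 0 X)) ^ 2 ≤ (C * δW * K₂) ^ 2 * ‖X‖ ^ 2 := by
    have h1 : 0 ≤ C * δW * p₀ (fderiv ℝ Xf 0 X) := by positivity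
    have h2 : C * δW * p₀ (fderiv ℝ Xf 0 X) ≤ C * δW * (K₂ * ‖X‖) := mul_le_mul_of_nonneg_left (hK0 X) (by positivity)
    calc (C * δW * p₀ (fderiv ℝ Xf 0 X)) ^ 2 ≤ (C * δW * (K₂ * ‖X‖)) ^ 2 := pow_le_pow_left₀ h1 h2 2
      _ = (C * δW * K₂) ^ 2 * ‖X‖ ^ 2 := by ring
  have hratio : 0 ≤ (((F.P Kt).L : ℝ) ^ (F.P Kt).d) ^ k / ((((F.P Kt).L : ℝ)) ^ 2 * ((F.P Kt).L : ℝ) ^ 2) ^ k := by positivity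
  have hinv : ((1 : ℝ) / 2)⁻¹ - 1 = 1 := by norm_num
  have hhalf : (1 : ℝ) - 1 / 2 = 1 / 2 := by norm_num
  rw [hinv, hhalf, one_mul, hcard] at key
  have h3 : (((F.P Kt).L : ℝ) ^ (F.P Kt).d) ^ k / ((((F.P Kt).L : ℝ)) ^ 2 * ((F.P Kt).L : ℝ) ^ 2) ^ k * (8 * ((F.P Kt).d : ℝ) * (((box (fun κ => (hi κ - lo κ + 1).toNat + 3) (fun κ => lo κ - 2)).image (fun z => (castSite z : Site (F.P Kt) k))).card : ℝ) * (C * δW * p₀ (fderiv ℝ Xf 0 X)) ^ 2)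
      ≤ (((F.P Kt).L : ℝ) ^ (F.P Kt).d) ^ k / ((((F.P Kt).L : ℝ)) ^ 2 * ((F.P Kt).L : ℝ) ^ 2) ^ k * (8 * ((F.P Kt).d : ℝ) * (((box (fun κ => (hi κ - lo κ + 1).toNat + 3) (fun κ => lo κ - 2)).image (fun z => (castSite z : Site (F.P Kt) k))).card : ℝ) * ((C * δW * K₂) ^ 2 * ‖X‖ ^ 2)) :=
    mul_le_mul_of_nonneg_left (mul_le_mul_of_nonneg_left hpK (by positivity)) hratio
  refine le_trans ?_ key
  linarith [h3]

end

end Summit.QuantumFields.YangMills.BalabanUVNodes.N12DirectChartPackageOfClassRowL1B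

end
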